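import Literature.MathematicalPhysics.QuantumLattice.PairFieldMomentum

/-!
# Vocabulary of the twist-averaging bound `TwistAveragingBound`
# (route `CooperSharpness`, item stmt-HubbardSuperconductivity-12854)

The support item `TwistAveragingBound` (a per-site mean-field pair penalty `(h/L²)·Δ_dᴴΔ_d` raises
the `(N, S^z = 0)`-sector ground energy of `hubbardTorus 2 L 1 U` by at most `C √h · L`) is proved by
testing the penalised Hamiltonian with CHARGE-TWISTED trial vectors and averaging over a momentum
window. This file only NAMES the objects of that proof (nothing is proved here beyond
`rfl`-unfoldings); the companion modules `CooperSharpnessTwistAveragingBoundModes` (momentum sum of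
the twisted pair weights), `CooperSharpnessTwistAveragingBoundCost` (energy cost of the `±` twists)
and `CooperSharpnessTwistAveragingBound` (the bound, `twistAveragingBound_proof`) prove everything
over them. (The same vocabulary serves the softness ceiling `TwistGap.TgTwistCeiling`.)

* `chargeTwist L k` — the spin-`↑` twist angles at pair momentum `k ∈ (ℤ/Lℤ)²`: the orbital `(y,↑)`
  is rotated by `2π (k·y)/L` (`k·y` in `ℤ/Lℤ`, representative in `{0,…,L-1}`), `(y,↓)` is untouched;
  the twist unitary is `fockTwist (chargeTwist L k) = exp[i Σ_y θ_k(y) n_{y↑}]`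
  (`HubbardLSMFillingProofs.fockTwist`), a Fulde–Ferrell / Lieb–Schultz–Mattis twist of one spin
  species, which shifts the PAIR momentum by `k`;
* `upDown L e x = c_{x↑} c_{x+e,↓}` and `downUp L e x = c_{x↓} c_{x+e,↑}` — the two bond pair
  annihilators whose difference (times `g e/√2`, summed over `e`) is Scalapino's local singlet pair
  `localPair g L x` (`localPair_eq_sum_upDown_sub_downUp`);
* `modeUpDown L e k = Σ_x conj χ_k(x) • upDown L e x`, `modeDownUp L e k` likewise — their
  operator-valued Fourier modes (Kennedy–Lieb–Shastry), in the `conj χ_k` convention of `pairFieldAt`.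

Sources: E. Lieb, T. Schultz, D. Mattis, Ann. Phys. 16 (1961) 407, App. B; M. Oshikawa, PRL 84
(2000) 1535; P. Fulde, R. A. Ferrell, Phys. Rev. 135 (1964) A550; T. Kennedy, E. H. Lieb,
B. S. Shastry, PRL 61 (1988) 2582; D. J. Scalapino, Phys. Rep. 250 (1995) 329, §2.
-/

set_option linter.dupNamespace false

noncomputable section

namespace Summit.HubbardSuperconductivity.HubbardSuperconductivity.Theorems.CooperSharpness

open Matrix Literature.MathematicalPhysics.QuantumLattice Literature.Probability.LatticeModels
open scoped ComplexConjugate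

/-- The spin-`↑` charge-twist angles at pair momentum `k ∈ (ℤ/Lℤ)²`: the orbital `(y, ↑)` is rotated
by `2π (k·y)/L` (`k·y` computed in `ℤ/Lℤ`, representative in `{0,…,L-1}`), the orbital `(y, ↓)` is
untouched (a one-species Lieb–Schultz–Mattis / Fulde–Ferrell twist, shifting the pair momentum by
`k`). Lieb–Schultz–Mattis, Ann. Phys. 16 (1961) 407, App. B; Oshikawa, PRL 84 (2000) 1535. [folklore] -/
def chargeTwist (L : ℕ) [NeZero L] (k : TorusSite 2 L) : Orb (FermionTorus 2 L) → ℝ := fun j =>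
  if (ofLex j).2 = 0 then
    2 * Real.pi / L * (((∑ i, k i * FermionTorus.toTorusSite (ofLex j).1 i).val : ℕ) : ℝ)
  else 0

/-- The `↑↓` bond pair annihilator `c_{x↑} c_{x+e,↓}` on the fermionic torus (`x ∈ (ℤ/Lℤ)²`, step
`e ∈ ℤ²` projected to the torus). Scalapino, Phys. Rep. 250 (1995) 329, §2 eq. (2.2). [folklore] -/
def upDown (L : ℕ) [NeZero L] (e : Site 2) (x : TorusSite 2 L) :
    Matrix (Finset (Orb (FermionTorus 2 L))) (Finset (Orb (FermionTorus 2 L))) ℂ :=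
  annihilation (orb (FermionTorus.ofTorusSite x) 0) *
    annihilation (orb (FermionTorus.ofTorusSite (x + Torus.proj L e)) 1)

/-- The `↓↑` bond pair annihilator `c_{x↓} c_{x+e,↑}` on the fermionic torus.
Scalapino, Phys. Rep. 250 (1995) 329, §2 eq. (2.2). [folklore] -/
def downUp (L : ℕ) [NeZero L] (e : Site 2) (x : TorusSite 2 L) :
    Matrix (Finset (Orb (FermionTorus 2 L))) (Finset (Orb (FermionTorus 2 L))) ℂ :=
  annihilation (orb (FermionTorus.ofTorusSite x) 1) *
    annihilation (orb (FermionTorus.ofTorusSite (x + Torus.proj L e)) 0)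

/-- The operator-valued Fourier mode `F¹_e(k) = Σ_x conj χ_k(x) • c_{x↑}c_{x+e,↓}` of the `↑↓` bond
pairs (`χ_k` the torus character; `conj χ_k` as in `pairFieldAt`).
Kennedy–Lieb–Shastry, PRL 61 (1988) 2582. [folklore] -/
def modeUpDown (L : ℕ) [NeZero L] (e : Site 2) (k : TorusSite 2 L) :
    Matrix (Finset (Orb (FermionTorus 2 L))) (Finset (Orb (FermionTorus 2 L))) ℂ :=
  ∑ x, conj (torusChar k x) • upDown L e x

/-- The operator-valued Fourier mode `F²_e(k) = Σ_x conj χ_k(x) • c_{x↓}c_{x+e,↑}` of the `↓↑` bond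
pairs. Kennedy–Lieb–Shastry, PRL 61 (1988) 2582. [folklore] -/
def modeDownUp (L : ℕ) [NeZero L] (e : Site 2) (k : TorusSite 2 L) :
    Matrix (Finset (Orb (FermionTorus 2 L))) (Finset (Orb (FermionTorus 2 L))) ℂ :=
  ∑ x, conj (torusChar k x) • downUp L e x

variable {L : ℕ} [NeZero L]

/-- The twist angle of an `↑` orbital: `θ_k(y,↑) = 2π (k·y)/L`. [folklore] -/
theorem chargeTwist_up (k : TorusSite 2 L) (y : FermionTorus 2 L) :
    chargeTwist L k (orb y 0) =
      2 * Real.pi / L * (((∑ i, k i * FermionTorus.toTorusSite y i).val : ℕ) : ℝ) := by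
  simp [chargeTwist]

/-- The twist angle of a `↓` orbital vanishes. [folklore] -/
theorem chargeTwist_down (k : TorusSite 2 L) (y : FermionTorus 2 L) :
    chargeTwist L k (orb y 1) = 0 := by
  simp [chargeTwist]

/-- The local singlet pair operator in terms of the bond pair annihilators:
`P_x = Σ_{e ∈ {0,±e₁,±e₂}} (g e/√2) (c_{x↑}c_{x+e,↓} − c_{x↓}c_{x+e,↑})` (definitional).
Scalapino, Phys. Rep. 250 (1995) 329, §2 eq. (2.2). [folklore] -/
theorem localPair_eq_sum_upDown_sub_downUp (g : Site 2 → ℝ) (x : TorusSite 2 L) :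
    localPair g L x = ∑ e ∈ insert 0 unitSteps,
      ((g e / Real.sqrt 2 : ℝ) : ℂ) • (upDown L e x - downUp L e x) := rfl

end Summit.HubbardSuperconductivity.HubbardSuperconductivity.Theorems.CooperSharpness
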